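import Literature.AlgebraicGeometry.Resolution.Blowups
import Literature.AlgebraicGeometry.Resolution.QuasiExcellentSchemes
import Mathlib.AlgebraicGeometry.IdealSheaf.Subscheme
import HarnessLib

/-!
# Principalization of ideal sheaves on regular excellent threefolds (Cossart–Piltant, Prop. 4.4)

Topic: `Literature/AlgebraicGeometry/Resolution`. One of the three characteristic-free
ingredients of Cossart–Piltant's patching (journal Prop. 4.6 = arXiv v1 Prop. 4.4), vendored as a
named fact over the blowing-up vocabulary of `Blowups.lean`:

> **Proposition 4.4 (journal; arXiv v1 Prop. 4.3) (Cossart–Piltant).** Let `𝒮` be a regular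
> Noetherian irreducible scheme of dimension three which is excellent and `𝓘 ⊆ 𝒪_𝒮` be a nonzero
> ideal sheaf. There exists a finite sequence `𝒮 =: 𝒮(0) ← 𝒮(1) ← ⋯ ← 𝒮(r)` with the following
> properties: (i) for each `j`, `𝒮(j+1)` is the blowing up along a regular integral subscheme
> `𝒴(j) ⊂ 𝒮(j)` with `𝒴(j) ⊆ {s_j ∈ 𝒮(j) : 𝓘𝒪_{𝒮(j),s_j}` is not locally principal`};
> (ii) `𝓘𝒪_{𝒮(r)}` is locally principal.

(Proof in the source: [CoP1] Prop. 4.2 made characteristic free by [CoP3] Thm. II.3.)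

* `IsLocallyPrincipalAt J x`, `IsLocallyPrincipal J` (Stacks 01WR: "locally generated by a
  single element");
* `IsRegularCentreBlowupSeq σ J` — `σ : S' → S` is a finite composition of blowing ups along
  regular integral closed subschemes lying in the non-locally-principal locus of the transform
  of `J` (an inductive predicate; the transform of `J` on `S(j)` is the inverse image ideal sheaf
  `J.comap`);
* `CossartPiltant2019Principalization` — the NAMED FACT;
* PROVED API: `IsEffectiveCartier.isLocallyPrincipal`, `isLocallyPrincipal_top`,
  `IsRegularCentreBlowupSeq.nil`-case principalization when `J` is already locally principal
  (`exists_principalization_of_isLocallyPrincipal`, non-vacuity of the conclusion shape),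
  `IsRegularCentreBlowupSeq.isProper` (such sequences are proper, given `Stacks02NS`),
  `CossartPiltant2019Principalization.exists_isProper`.

## Sources

* V. Cossart, O. Piltant, J. Algebra 529 (2019) 268–535, Prop. 4.4 (arXiv:1412.0868 v1:
  Prop. 4.3, p. 50). [CossartPiltant2019]
* V. Cossart, O. Piltant, J. Algebra 320 (2008), Prop. 4.2 ([CoP1]). [CossartPiltant2008]
* The Stacks Project, Tag 01WR. [StacksProject]
-/

noncomputable section

open CategoryTheory CategoryTheory.Limits AlgebraicGeometry TopologicalSpace

namespace Literature.AlgebraicGeometry.Resolution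

universe u

/-! ## Locally principal ideal sheaves -/

/-- The ideal sheaf `J` is **locally principal at `x`**: on some affine open neighbourhood `U`
of `x`, `J(U)` is generated by one element (Stacks 01WR: "a locally principal closed subscheme
… is a closed subscheme whose sheaf of ideals is locally generated by a single element").
[cite: StacksProject, Tag 01WR] -/
def IsLocallyPrincipalAt {X : Scheme.{u}} (J : X.IdealSheafData) (x : X) : Prop :=
  ∃ U : X.affineOpens, x ∈ (U : X.Opens) ∧ ∃ f : Γ(X, U), J.ideal U = Ideal.span {f}

/-- The ideal sheaf `J` is **locally principal** (locally generated by a single element).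
[cite: StacksProject, Tag 01WR] -/
def IsLocallyPrincipal {X : Scheme.{u}} (J : X.IdealSheafData) : Prop :=
  ∀ x : X, IsLocallyPrincipalAt J x

/-- Effective Cartier ideal sheaves are locally principal. [folklore] -/
theorem IsEffectiveCartier.isLocallyPrincipal
    {X : Scheme.{u}} {J : X.IdealSheafData} (h : IsEffectiveCartier J) : IsLocallyPrincipal J :=
  fun x => by
    obtain ⟨U, hxU, f, -, hf⟩ := h x
    exact ⟨U, hxU, f, hf⟩

/-- The unit ideal sheaf is locally principal. [folklore] -/
theorem isLocallyPrincipal_top (X : Scheme.{u}) :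
    IsLocallyPrincipal (⊤ : X.IdealSheafData) :=
  (isEffectiveCartier_top (X := X)).isLocallyPrincipal

/-! ## Sequences of blowing ups along regular centres -/

open Scheme.IdealSheafData in
/-- **`σ : S' ⟶ S` is a finite composition of blowing ups along regular integral centres lying in
the non-locally-principal locus of (the transforms of) `J`** — the shape of the sequence in
Cossart–Piltant 2019, Prop. 4.4 (i): the empty composition is the identity; a composition
`σ : S' → S` may be extended by a blowing up `τ : S'' → S'` along the reduced (integral and
regular) closed subscheme on a closed subset `Y ⊆ S'` all of whose points are points where
`J𝒪_{S'} = J.comap σ` is not locally principal. [cite: CossartPiltant2019, Prop. 4.4 (i) (arXiv v1: Prop. 4.3)] -/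
inductive IsRegularCentreBlowupSeq :
    ∀ {S' S : Scheme.{u}}, (S' ⟶ S) → S.IdealSheafData → Prop
  /-- the empty sequence -/
  | nil {S : Scheme.{u}} (J : S.IdealSheafData) : IsRegularCentreBlowupSeq (𝟙 S) J
  /-- one more blowing up along a regular integral centre in the non-principal locus -/
  | cons {S'' S' S : Scheme.{u}} (τ : S'' ⟶ S') (σ : S' ⟶ S) (J : S.IdealSheafData)
      (Y : Closeds S') :
      IsRegularCentreBlowupSeq σ J →
      IsIntegral (vanishingIdeal Y).subscheme →
      Scheme.IsRegular (vanishingIdeal Y).subscheme →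
      (∀ y ∈ (Y : Set S'), ¬ IsLocallyPrincipalAt (J.comap σ) y) →
      IsBlowup τ (vanishingIdeal Y) →
      IsRegularCentreBlowupSeq (τ ≫ σ) J

/-! ## The named fact -/

/-- NAMED FACT — **Cossart–Piltant 2019, Prop. 4.4 (arXiv v1: Prop. 4.3): principalization on
regular excellent threefolds.** For every regular, Noetherian, integral ("irreducible" and
regular), excellent scheme `S` of dimension three and every nonzero ideal sheaf `J` on `S`
there is a finite composition `σ : S' → S` of blowing ups along regular integral centres lying
in the non-locally-principal loci of the transforms of `J` such that `J𝒪_{S'} = J.comap σ` is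
locally principal. Users take `(h : CossartPiltant2019Principalization)`.
[cite: CossartPiltant2019, Prop. 4.4 (arXiv v1: Prop. 4.3)] -/
def CossartPiltant2019Principalization : Prop :=
  ∀ (S : Scheme.{u}) [IsIntegral S] [IsNoetherian S], Scheme.IsRegular S → Scheme.IsExcellent S →
    topologicalKrullDim S = 3 → ∀ J : S.IdealSheafData, J ≠ ⊥ →
      ∃ (S' : Scheme.{u}) (σ : S' ⟶ S), IsRegularCentreBlowupSeq σ J ∧ IsLocallyPrincipal (J.comap σ)

/-! ## API -/

/-- The conclusion shape of `CossartPiltant2019Principalization` is inhabited by the empty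
sequence when `J` is already locally principal (e.g. `J = ⊤`). [folklore] -/
theorem exists_principalization_of_isLocallyPrincipal {S : Scheme.{u}} (J : S.IdealSheafData)
    (hJ : IsLocallyPrincipal J) :
    ∃ (S' : Scheme.{u}) (σ : S' ⟶ S), IsRegularCentreBlowupSeq σ J ∧
      IsLocallyPrincipal (J.comap σ) :=
  ⟨S, 𝟙 S, IsRegularCentreBlowupSeq.nil J, by rwa [Scheme.IdealSheafData.comap_id]⟩

/-- A single blowing up along a regular integral centre lying in the non-locally-principal
locus of `J` is a (one-step) sequence. [folklore] -/
theorem IsRegularCentreBlowupSeq.single {S' S : Scheme.{u}} (τ : S' ⟶ S) (J : S.IdealSheafData)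
    (Y : Closeds S) (hint : IsIntegral (Scheme.IdealSheafData.vanishingIdeal Y).subscheme)
    (hreg : Scheme.IsRegular (Scheme.IdealSheafData.vanishingIdeal Y).subscheme)
    (hY : ∀ y ∈ (Y : Set S), ¬ IsLocallyPrincipalAt J y)
    (hτ : IsBlowup τ (Scheme.IdealSheafData.vanishingIdeal Y)) :
    IsRegularCentreBlowupSeq τ J := by
  have := IsRegularCentreBlowupSeq.cons τ (𝟙 S) J Y (IsRegularCentreBlowupSeq.nil J) hint hreg
    (by rwa [Scheme.IdealSheafData.comap_id]) hτ
  rwa [Category.comp_id] at this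

/-- **A sequence of blowing ups along regular centres is proper** over a locally Noetherian base,
given properness of blowing ups (`Stacks02NS`). [cite: StacksProject, Tag 02NS] -/
theorem IsRegularCentreBlowupSeq.isProper (h02 : Stacks02NS.{u}) {S' S : Scheme.{u}} {σ : S' ⟶ S}
    {J : S.IdealSheafData} (h : IsRegularCentreBlowupSeq σ J) (hS : IsLocallyNoetherian S) :
    IsProper σ := by
  induction h with
  | nil J => infer_instance
  | cons τ σ J Y hσ hint hreg hY hτ ih =>
    haveI := ih hS
    haveI : IsLocallyNoetherian _ := LocallyOfFiniteType.isLocallyNoetherian σ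
    haveI := h02.of_isLocallyNoetherian τ _ hτ
    infer_instance

/-- Hence, under `Stacks02NS`, the principalizing morphism of `CossartPiltant2019Principalization`
is proper. [cite: CossartPiltant2019, Prop. 4.4 (arXiv v1: Prop. 4.3)] -/
theorem CossartPiltant2019Principalization.exists_isProper
    (h : CossartPiltant2019Principalization.{u}) (h02 : Stacks02NS.{u}) (S : Scheme.{u})
    [IsIntegral S] [IsNoetherian S] (hreg : Scheme.IsRegular S) (hexc : Scheme.IsExcellent S)
    (hdim : topologicalKrullDim S = 3) (J : S.IdealSheafData) (hJ : J ≠ ⊥) :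
    ∃ (S' : Scheme.{u}) (σ : S' ⟶ S), IsProper σ ∧ IsRegularCentreBlowupSeq σ J ∧
      IsLocallyPrincipal (J.comap σ) := by
  obtain ⟨S', σ, hσ, hp⟩ := h S hreg hexc hdim J hJ
  exact ⟨S', σ, hσ.isProper h02 inferInstance, hσ, hp⟩

end Literature.AlgebraicGeometry.Resolution

end
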